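import Summits.Ventures.PackingBounds.Configurations.E8PairCounts

/-!
# An orthonormal `D₄`-frame inside every `240`-point kissing configuration of `ℝ⁸` (Bannai–Sloane, step (ii), part 3)

Framing: lottery ticket; floor = certified bounds/negative ranges. Venture `PackingBounds` (cell
`pub-packcert`, seat `pub-packcert-energy`).

Let `C ⊂ S⁷` be any kissing configuration with `|C| = 240`. Using the closure (`E8Closure`) and counting
(`E8PairCounts`) files we construct INSIDE `C`:

* an orthogonal pair `a ⊥ b` (`exists_orth`, from the `126` orthogonal neighbours);
* for such a pair, the "glue" analysis of the `12` points `y` with `⟨a,y⟩ = ⟨b,y⟩ = 1/2`: two distinct such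
  points have inner product `0` or `1/2`, and inner product `0` forces `y' = a + b - y` (`pattern_inner_cases`,
  `pattern_eq_of_inner_zero`); hence a third point `c = y - y' ∈ C` orthogonal to `a, b` (`exists_orth3`);
* from the triple existence lemma, an orthonormal triple `a₁, a₂, a₃ ∈ C` and `d ∈ C` with `⟨aᵢ,d⟩ = 1/2`, and then
  `a₄ := 2d - a₁ - a₂ - a₃ ∈ C` (three root subtractions and one root addition) completing an orthonormal
  `4`-frame with `d = (a₁ + a₂ + a₃ + a₄)/2 ∈ C` — a `D₄` root subsystem of `√2·C` (`exists_frame`).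

## References
* E. Bannai, N. J. A. Sloane, Canad. J. Math. 33 (1981) 437–449 (= Conway–Sloane, *SPLAG*, Ch. 14, Thm. 7–8). [`ConwaySloane1999`]
-/

namespace Summit.Ventures.PackingBounds.Config.E8Frame

open Finset

section config

variable {C : Finset (EuclideanSpace ℝ (Fin 8))} (h1 : ∀ x ∈ C, ‖x‖ = 1)
  (h2 : ∀ x ∈ C, ∀ y ∈ C, x ≠ y → inner ℝ x y ≤ 1 / 2) (hcard : C.card = 240)
include h1 h2 hcard

omit h1 h2 in
/-- `C` is nonempty. -/
theorem exists_mem : ∃ a, a ∈ C := by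
  have : C.Nonempty := by rw [← Finset.card_pos, hcard]; norm_num
  exact this

/-- Every point of `C` has an orthogonal point in `C`. -/
theorem exists_orth {a : EuclideanSpace ℝ (Fin 8)} (ha : a ∈ C) : ∃ b ∈ C, inner ℝ a b = 0 := by
  obtain ⟨-, -, h0, -⟩ := E8Design.nbrCount8_eq h1 h2 hcard ha
  have hne : ((C.erase a).filter fun y => inner ℝ a y = 0).Nonempty := by
    rw [← Finset.card_pos]
    unfold E8Design.nbrCount8 at h0
    omega
  obtain ⟨b, hb⟩ := hne
  rw [Finset.mem_filter] at hb
  exact ⟨b, Finset.mem_of_mem_erase hb.1, hb.2⟩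

/-- **Glue lemma 1.** For orthogonal `a, b ∈ C`, two distinct points `y, y'` of `C` with
`⟨a,·⟩ = ⟨b,·⟩ = 1/2` have inner product `0` or `1/2` (their components orthogonal to `a, b` have norm²
`1/2`, so Cauchy–Schwarz excludes `-1` and `-1/2`). -/
theorem pattern_inner_cases {a b y y' : EuclideanSpace ℝ (Fin 8)} (ha : a ∈ C) (hb : b ∈ C)
    (hab : inner ℝ a b = 0) (hy : y ∈ C) (hy' : y' ∈ C) (hne : y ≠ y')
    (hay : inner ℝ a y = 1 / 2) (hby : inner ℝ b y = 1 / 2)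
    (hay' : inner ℝ a y' = 1 / 2) (hby' : inner ℝ b y' = 1 / 2) :
    inner ℝ y y' = 0 ∨ inner ℝ y y' = 1 / 2 := by
  have haa : inner ℝ a a = 1 := by rw [real_inner_self_eq_norm_sq, h1 a ha, one_pow]
  have hbb : inner ℝ b b = 1 := by rw [real_inner_self_eq_norm_sq, h1 b hb, one_pow]
  have hyy : inner ℝ y y = 1 := by rw [real_inner_self_eq_norm_sq, h1 y hy, one_pow]
  have hyy' : inner ℝ y' y' = 1 := by rw [real_inner_self_eq_norm_sq, h1 y' hy', one_pow]
  have hba : inner ℝ b a = 0 := by rw [real_inner_comm]; exact hab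
  have hya : inner ℝ y a = 1 / 2 := by rw [real_inner_comm]; exact hay
  have hyb : inner ℝ y b = 1 / 2 := by rw [real_inner_comm]; exact hby
  have hy'a : inner ℝ y' a = 1 / 2 := by rw [real_inner_comm]; exact hay'
  have hy'b : inner ℝ y' b = 1 / 2 := by rw [real_inner_comm]; exact hby'
  set g : EuclideanSpace ℝ (Fin 8) := y - (1 / 2 : ℝ) • (a + b) with hg
  set g' : EuclideanSpace ℝ (Fin 8) := y' - (1 / 2 : ℝ) • (a + b) with hg'
  have hgg' : inner ℝ g g' = inner ℝ y y' - 1 / 2 := by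
    simp only [hg, hg', inner_sub_left, inner_sub_right, inner_smul_left, inner_smul_right,
      inner_add_left, inner_add_right, haa, hbb, hab, hba, hya, hyb, hay', hby', RCLike.conj_to_real]
    ring
  have hgg : inner ℝ g g = 1 / 2 := by
    simp only [hg, inner_sub_left, inner_sub_right, inner_smul_left, inner_smul_right,
      inner_add_left, inner_add_right, haa, hbb, hab, hba, hya, hyb, hay, hby, hyy, RCLike.conj_to_real]
    ring
  have hg'g' : inner ℝ g' g' = 1 / 2 := by
    simp only [hg', inner_sub_left, inner_sub_right, inner_smul_left, inner_smul_right,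
      inner_add_left, inner_add_right, haa, hbb, hab, hba, hy'a, hy'b, hay', hby', hyy', RCLike.conj_to_real]
    ring
  have hcs := real_inner_mul_inner_self_le g g'
  rw [hgg', hgg, hg'g'] at hcs
  rcases Kissing.kissing_dim8_inner_of_card_eq_240 C h1 h2 hcard hy hy' hne with h | h | h | h <;>
    (rw [h] at hcs ⊢) <;> first | (norm_num at hcs; done) | norm_num

omit h2 hcard in
/-- **Glue lemma 2.** In the situation of `pattern_inner_cases`, inner product `0` forces `y' = a + b - y`
(the glue components are antipodal). -/
theorem pattern_eq_of_inner_zero {a b y y' : EuclideanSpace ℝ (Fin 8)} (ha : a ∈ C) (hb : b ∈ C)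
    (hab : inner ℝ a b = 0) (hy : y ∈ C) (hy' : y' ∈ C)
    (hay : inner ℝ a y = 1 / 2) (hby : inner ℝ b y = 1 / 2)
    (hay' : inner ℝ a y' = 1 / 2) (hby' : inner ℝ b y' = 1 / 2) (h0 : inner ℝ y y' = 0) :
    y' = a + b - y := by
  have haa : inner ℝ a a = 1 := by rw [real_inner_self_eq_norm_sq, h1 a ha, one_pow]
  have hbb : inner ℝ b b = 1 := by rw [real_inner_self_eq_norm_sq, h1 b hb, one_pow]
  have hyy : inner ℝ y y = 1 := by rw [real_inner_self_eq_norm_sq, h1 y hy, one_pow]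
  have hyy' : inner ℝ y' y' = 1 := by rw [real_inner_self_eq_norm_sq, h1 y' hy', one_pow]
  have hba : inner ℝ b a = 0 := by rw [real_inner_comm]; exact hab
  have hya : inner ℝ y a = 1 / 2 := by rw [real_inner_comm]; exact hay
  have hyb : inner ℝ y b = 1 / 2 := by rw [real_inner_comm]; exact hby
  have hy'a : inner ℝ y' a = 1 / 2 := by rw [real_inner_comm]; exact hay'
  have hy'b : inner ℝ y' b = 1 / 2 := by rw [real_inner_comm]; exact hby'
  have hy'y : inner ℝ y' y = 0 := by rw [real_inner_comm]; exact h0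
  have hz : inner ℝ (y + y' - (a + b)) (y + y' - (a + b)) = 0 := by
    simp only [inner_sub_left, inner_sub_right, inner_add_left, inner_add_right, haa, hbb, hab, hba,
      hya, hyb, hy'a, hy'b, hay, hby, hay', hby', hyy, hyy', h0, hy'y]
    ring
  rw [real_inner_self_eq_norm_sq, sq_eq_zero_iff, norm_eq_zero, sub_eq_zero] at hz
  rw [← hz]; abel

/-- An orthogonal pair of `C` extends to an orthogonal triple inside `C` (difference of two suitable points
of the pattern class `⟨a,·⟩ = ⟨b,·⟩ = 1/2`). -/
theorem exists_orth3 {a b : EuclideanSpace ℝ (Fin 8)} (ha : a ∈ C) (hb : b ∈ C) (hab : inner ℝ a b = 0) :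
    ∃ c ∈ C, inner ℝ a c = 0 ∧ inner ℝ b c = 0 := by
  set S := C.filter (fun y => inner ℝ a y = 1 / 2 ∧ inner ℝ b y = 1 / 2) with hS
  have hS12 : S.card = 12 := E8PairCounts.card_half_half h1 h2 hcard ha hb hab
  have hSne : S.Nonempty := by rw [← Finset.card_pos, hS12]; norm_num
  obtain ⟨y, hyS⟩ := hSne
  have hy := (Finset.mem_filter.mp hyS)
  set S' := (S.erase y).erase (a + b - y) with hS'
  have hS'card : 10 ≤ S'.card := by
    have e1 : (S.erase y).card = 11 := by rw [Finset.card_erase_of_mem hyS, hS12]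
    have e3 : (S.erase y).card - 1 ≤ S'.card := Finset.pred_card_le_card_erase
    omega
  have hS'ne : S'.Nonempty := by rw [← Finset.card_pos]; omega
  obtain ⟨y', hy'S'⟩ := hS'ne
  have hy'1 := Finset.mem_erase.mp hy'S'
  have hy'2 := Finset.mem_erase.mp hy'1.2
  have hy' := Finset.mem_filter.mp hy'2.2
  have hne : y ≠ y' := fun h => hy'2.1 h.symm
  have hhalf : inner ℝ y y' = 1 / 2 := by
    rcases pattern_inner_cases h1 h2 hcard ha hb hab hy.1 hy'.1 hne hy.2.1 hy.2.2 hy'.2.1 hy'.2.2 with h | h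
    · exact absurd (pattern_eq_of_inner_zero h1 ha hb hab hy.1 hy'.1 hy.2.1 hy.2.2 hy'.2.1 hy'.2.2 h)
        hy'1.1
    · exact h
  refine ⟨y - y', E8Closure.sub_mem h1 h2 hcard hy.1 hy'.1 hhalf, ?_, ?_⟩
  · rw [inner_sub_right, hy.2.1, hy'.2.1]; norm_num
  · rw [inner_sub_right, hy.2.2, hy'.2.2]; norm_num

/-- **The `D₄` frame.** Every `240`-point kissing configuration of `ℝ⁸` contains four pairwise orthogonal
points `a₁, a₂, a₃, a₄` together with their half-sum `d = (a₁ + a₂ + a₃ + a₄)/2`.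
[cite: ConwaySloane1999, Ch. 14 Thm. 7] -/
theorem exists_frame : ∃ a₁ ∈ C, ∃ a₂ ∈ C, ∃ a₃ ∈ C, ∃ a₄ ∈ C, ∃ d ∈ C,
    inner ℝ a₁ a₂ = 0 ∧ inner ℝ a₁ a₃ = 0 ∧ inner ℝ a₁ a₄ = 0 ∧ inner ℝ a₂ a₃ = 0 ∧ inner ℝ a₂ a₄ = 0 ∧
    inner ℝ a₃ a₄ = 0 ∧ d = (1 / 2 : ℝ) • (a₁ + a₂ + a₃ + a₄) := by
  obtain ⟨a, ha⟩ := exists_mem hcard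
  obtain ⟨b, hb, hab⟩ := exists_orth h1 h2 hcard ha
  obtain ⟨c, hc, hac, hbc⟩ := exists_orth3 h1 h2 hcard ha hb hab
  obtain ⟨a₁, ha₁, a₂, ha₂, a₃, ha₃, d, hd, h12, h13, h23, hd1, hd2, hd3⟩ :=
    E8PairCounts.exists_triple_half h1 h2 hcard ha hb hc hab hac hbc
  have h11 : inner ℝ a₁ a₁ = 1 := by rw [real_inner_self_eq_norm_sq, h1 a₁ ha₁, one_pow]
  have h22 : inner ℝ a₂ a₂ = 1 := by rw [real_inner_self_eq_norm_sq, h1 a₂ ha₂, one_pow]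
  have h33 : inner ℝ a₃ a₃ = 1 := by rw [real_inner_self_eq_norm_sq, h1 a₃ ha₃, one_pow]
  have hdd : inner ℝ d d = 1 := by rw [real_inner_self_eq_norm_sq, h1 d hd, one_pow]
  have h21 : inner ℝ a₂ a₁ = 0 := by rw [real_inner_comm]; exact h12
  have h31 : inner ℝ a₃ a₁ = 0 := by rw [real_inner_comm]; exact h13
  have h32 : inner ℝ a₃ a₂ = 0 := by rw [real_inner_comm]; exact h23
  have hd1' : inner ℝ d a₁ = 1 / 2 := by rw [real_inner_comm]; exact hd1
  have hd2' : inner ℝ d a₂ = 1 / 2 := by rw [real_inner_comm]; exact hd2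
  have hd3' : inner ℝ d a₃ = 1 / 2 := by rw [real_inner_comm]; exact hd3
  -- three root subtractions
  have e1 : d - a₁ ∈ C := E8Closure.sub_mem h1 h2 hcard hd ha₁ hd1'
  have e2 : d - a₁ - a₂ ∈ C :=
    E8Closure.sub_mem h1 h2 hcard e1 ha₂ (by rw [inner_sub_left, hd2', h12]; norm_num)
  have e3 : d - a₁ - a₂ - a₃ ∈ C :=
    E8Closure.sub_mem h1 h2 hcard e2 ha₃ (by rw [inner_sub_left, inner_sub_left, hd3', h13, h23]; norm_num)
  -- one root addition
  have e4 : d + (d - a₁ - a₂ - a₃) ∈ C :=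
    E8Closure.add_mem h1 h2 hcard hd e3 (by
      rw [inner_sub_right, inner_sub_right, inner_sub_right, hdd, hd1', hd2', hd3']; norm_num)
  refine ⟨a₁, ha₁, a₂, ha₂, a₃, ha₃, d + (d - a₁ - a₂ - a₃), e4, d, hd, h12, h13, ?_, h23, ?_, ?_, ?_⟩
  · rw [inner_add_right, inner_sub_right, inner_sub_right, inner_sub_right, h11, h12, h13,
      real_inner_comm, hd1']; norm_num
  · rw [inner_add_right, inner_sub_right, inner_sub_right, inner_sub_right, h21, h22, h23,
      real_inner_comm, hd2']; norm_num
  · rw [inner_add_right, inner_sub_right, inner_sub_right, inner_sub_right, h31, h32, h33,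
      real_inner_comm, hd3']; norm_num
  · have h2d : (1 / 2 : ℝ) • d + (1 / 2 : ℝ) • d = d := by rw [← add_smul]; norm_num
    have key : (1 / 2 : ℝ) • (a₁ + a₂ + a₃ + (d + (d - a₁ - a₂ - a₃))) =
        (1 / 2 : ℝ) • d + (1 / 2 : ℝ) • d := by
      simp only [smul_add, smul_sub]
      abel
    rw [key, h2d]

end config

end Summit.Ventures.PackingBounds.Config.E8Frame
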